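import Mathlib
import Summits.Ventures.PercRepro2.Defs
import Summits.Ventures.PercRepro2.Independence
import Summits.Ventures.PercRepro2.Harris
import Summits.Ventures.PercRepro2.Graph
import Summits.Ventures.PercRepro2.Events
import Summits.Ventures.PercRepro2.PartitionThree
import Summits.Ventures.PercRepro2.ZCLeafReductionsGraph

/-!
# (ZC) reduces to up-sets blind to `a₃` and `o` (blind cell PercRepro2, mine-a g27)

For an up-set `𝓔` of vertex sets let `𝓔⁺⁺ := {S | insert a₃ (insert o S) ∈ 𝓔}` — the up-set that ignores
whether `a₃` and `o` belong to the cluster.  The (ZC) expression of `𝓔` dominates that of `𝓔⁺⁺`: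
`Z(𝓔) − Z(𝓔⁺⁺) = (P(U⁺⁺) − P(U)) · (P(D)P(eL) − P(B)P(e¬L)) + P(B) · (P(U⁺⁺ ∩ e¬L) − P(U ∩ e¬L)) ≥ 0`,
because `U ⊆ U⁺⁺`, `U ∩ eL = U⁺⁺ ∩ eL` (on `eL` the cluster already contains `a₃` and `o`) and
lemma (P1) (`partitionThree_lattice`).  Hence **(ZC) for every cluster up-set follows from (ZC) for the
up-sets blind to `a₃` and `o`** (`zc_of_blind`): the general conjecture only has to be proved for
events that do not look at the two marks — in the flow picture of `ZCK4`, the pieces `Z_S` of the sets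
`S` missing `a₃` or `o` are the sources of the flow, and the reduction pushes them into the blind sets.
-/

namespace Summit.Ventures.PercRepro2

variable {V : Type*} {E : Type*} [Fintype E] [DecidableEq E] {R : Type*} [CommRing R] [LinearOrder R]
  [IsStrictOrderedRing R]

/-- The blind up-set `{S | insert a₃ (insert o S) ∈ 𝓔}` is an up-set. -/
lemma isUpperSet_blindShift {𝓔 : Set (Set V)} (h𝓔 : IsUpperSet 𝓔) (a₃ o : V) :
    IsUpperSet {S : Set V | insert a₃ (insert o S) ∈ 𝓔} :=
  fun _ _ hST hS => h𝓔 (Set.insert_subset_insert (Set.insert_subset_insert hST)) hS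

/-- The blind up-set does not look at `a₃` and `o`. -/
lemma blindShift_blind (𝓔 : Set (Set V)) (a₃ o : V) (S : Set V) :
    S ∈ {S : Set V | insert a₃ (insert o S) ∈ 𝓔} ↔
      insert a₃ (insert o S) ∈ {S : Set V | insert a₃ (insert o S) ∈ 𝓔} := by
  simp only [Set.mem_setOf_eq, Set.insert_comm a₃ o (insert a₃ (insert o S)), Set.insert_idem]
  rw [Set.insert_comm o a₃ (insert o S), Set.insert_idem, Set.insert_comm a₃ o]

/-- **The blind reduction**: the (ZC) expression of an up-set dominates the (ZC) expression of the
up-set blind to `a₃` and `o`. -/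
theorem zc_blind_le {ends : E → Sym2 V} {p : E → R} (hp : IsProbVec p) (a₁ a₃ o : V)
    {𝓔 : Set (Set V)} (h𝓔 : IsUpperSet 𝓔) :
    let e := connEvent ends a₁ a₃
    let L' := connEvent ends a₁ o
    let γ := connEvent ends a₃ o
    let U := clusterInEvent ends a₁ 𝓔
    let U' := clusterInEvent ends a₁ {S | insert a₃ (insert o S) ∈ 𝓔}
    prob p (eᶜ ∩ L'ᶜ ∩ γᶜ) * (prob p (U' ∩ (e ∩ L')) - prob p U' * prob p (e ∩ L'))
      - prob p (eᶜ ∩ L'ᶜ ∩ γ) * (prob p (U' ∩ (e ∩ L'ᶜ)) - prob p U' * prob p (e ∩ L'ᶜ)) ≤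
    prob p (eᶜ ∩ L'ᶜ ∩ γᶜ) * (prob p (U ∩ (e ∩ L')) - prob p U * prob p (e ∩ L'))
      - prob p (eᶜ ∩ L'ᶜ ∩ γ) * (prob p (U ∩ (e ∩ L'ᶜ)) - prob p U * prob p (e ∩ L'ᶜ)) := by
  intro e L' γ U U'
  -- `U ⊆ U'`
  have hsub : U ⊆ U' := by
    intro ω hω
    simp only [U, U', mem_clusterInEvent, Set.mem_setOf_eq] at hω ⊢
    exact h𝓔 (Set.subset_insert _ _ |>.trans (Set.subset_insert _ _)) hω
  -- on `e ∩ L'` the two up-set events coincide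
  have hUeL : U' ∩ (e ∩ L') = U ∩ (e ∩ L') := by
    ext ω
    simp only [U, U', e, L', Set.mem_inter_iff, mem_clusterInEvent, Set.mem_setOf_eq, mem_connEvent]
    constructor
    · rintro ⟨hU, h13, h1o⟩
      refine ⟨?_, h13, h1o⟩
      rwa [Set.insert_eq_of_mem (mem_cluster.2 h1o), Set.insert_eq_of_mem (mem_cluster.2 h13)] at hU
    · rintro ⟨hU, h13, h1o⟩
      refine ⟨?_, h13, h1o⟩
      rwa [Set.insert_eq_of_mem (mem_cluster.2 h1o), Set.insert_eq_of_mem (mem_cluster.2 h13)]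
  -- lemma (P1) for the marks `(a₁, a₃, o)`: `P(B) · P(e¬L) ≤ P(eL) · P(D)`
  have hP1 : prob p (e ∩ L'ᶜ) * prob p (eᶜ ∩ L'ᶜ ∩ γ) ≤
      prob p (e ∩ L') * prob p (eᶜ ∩ L'ᶜ ∩ γᶜ) := by
    have h := partitionThree_lattice hp ends a₁ a₃ o
    rw [partBCa_eq_three, partAll_eq_ab_ac] at h
    simpa only [partABc, partApart, e, L', γ] using h
  have hΔ : prob p U ≤ prob p U' := prob_mono hp hsub
  have hΔ' : prob p (U ∩ (e ∩ L'ᶜ)) ≤ prob p (U' ∩ (e ∩ L'ᶜ)) :=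
    prob_mono hp (Set.inter_subset_inter_left _ hsub)
  have hB := prob_nonneg hp (eᶜ ∩ L'ᶜ ∩ γ)
  rw [hUeL]
  nlinarith [mul_nonneg (sub_nonneg.2 hΔ) (sub_nonneg.2 hP1), mul_nonneg hB (sub_nonneg.2 hΔ')]

/-- **(ZC) for every cluster up-set follows from (ZC) for the up-sets blind to `a₃` and `o`**: if the
(ZC) expression is nonnegative for every up-set `𝓔'` with `S ∈ 𝓔' ↔ insert a₃ (insert o S) ∈ 𝓔'`, it is
nonnegative for every up-set. -/
theorem zc_of_blind {ends : E → Sym2 V} {p : E → R} (hp : IsProbVec p) (a₁ a₃ o : V)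
    (hblind : ∀ 𝓔' : Set (Set V), IsUpperSet 𝓔' →
      (∀ S, S ∈ 𝓔' ↔ insert a₃ (insert o S) ∈ 𝓔') →
      let e := connEvent ends a₁ a₃
      let L' := connEvent ends a₁ o
      let γ := connEvent ends a₃ o
      let U := clusterInEvent ends a₁ 𝓔'
      0 ≤ prob p (eᶜ ∩ L'ᶜ ∩ γᶜ) * (prob p (U ∩ (e ∩ L')) - prob p U * prob p (e ∩ L'))
        - prob p (eᶜ ∩ L'ᶜ ∩ γ) * (prob p (U ∩ (e ∩ L'ᶜ)) - prob p U * prob p (e ∩ L'ᶜ)))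
    {𝓔 : Set (Set V)} (h𝓔 : IsUpperSet 𝓔) :
    let e := connEvent ends a₁ a₃
    let L' := connEvent ends a₁ o
    let γ := connEvent ends a₃ o
    let U := clusterInEvent ends a₁ 𝓔
    0 ≤ prob p (eᶜ ∩ L'ᶜ ∩ γᶜ) * (prob p (U ∩ (e ∩ L')) - prob p U * prob p (e ∩ L'))
      - prob p (eᶜ ∩ L'ᶜ ∩ γ) * (prob p (U ∩ (e ∩ L'ᶜ)) - prob p U * prob p (e ∩ L'ᶜ)) := by
  intro e L' γ U
  have h1 := zc_blind_le (ends := ends) hp a₁ a₃ o h𝓔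
  have h2 := hblind _ (isUpperSet_blindShift h𝓔 a₃ o) (blindShift_blind 𝓔 a₃ o)
  simp only at h1 h2
  exact le_trans h2 h1

end Summit.Ventures.PercRepro2
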